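import Summits.MatrixMultiplication.OmegaCensus.DominoZ17StructSixDataE2v
import HarnessLib

/-!
# Excluded list (literal chunks) and codes for the structural part-`6` route, `p = 17` (file 3 of 3)

ω-census `pub-omega`, family (b3), seat pub-omega-group gen 25.  Framing: lottery ticket; floor = certified bounds/negative
ranges.  VALUE: per-prime kernel data of the structural part-`6` route WITHOUT the pigeonhole (`DominoZpZpStructSixWide*.lean`)
for `p = 17` — target: the OPEN census cell `(1,6,16)@289` (`A = ℤ₁₇²`) and every larger order with such a quotient; NOT progress on ω.

-/

namespace Summit.MatrixMultiplication.OmegaCensus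

open ZpZpDomino

namespace ZpZpDomino

/-- The same codes, sorted (for the balanced key tree) — chunk 5 of 5. [folklore] -/
def ecsZ17s6v_5 : List ℕ := [
  33911159644950, 33911165188908, 33911234352114, 33911234354466, 33911235996750, 33911447647350, 33911447764950,
  33911476471992, 33911718710940, 33911724360150, 33913130986098, 33913131003150, 33913171327602, 33915114060786,
  33925559997798, 33939124456902, 34008043510014, 34008043711698, 34105214138514, 34589377658892, 34589377673298,
  34589382513714, 34589417894850, 34591354042092, 34603218004950, 34603223884950, 34603500477756, 34605235682850,
  34617341764950, 34690220379192, 37980492079602, 37980492085032, 37980492096456, 37980492197634, 37980492903822,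
  37980493155192, 37980499609080, 37980572803614, 37980776201928, 37980814913202, 37980855262350, 37980861026808,
  37981057034844, 37981057049250, 37982471053716, 37984446851022, 37994373753966, 37998570495480, 38008215007602,
  38077381092366, 38077382739438, 38077387090050, 38105104017960, 38107040991096, 38176247427108, 38188393862808,
  38658716816286, 38854470499950, 39447668522850, 42728053740750, 42728055354222, 42728099724702, 42728336067480,
  42730030916622, 42730313391822, 42741894876786, 43406276681544, 43406277603528, 43406599491192, 43422095276280,
  43503165672744, 44181388745592, 66465861160812, 66465861257292, 66465862080396, 66465873492348, 66465941964114,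
  66466426108908, 66466431854550, 66467849995890, 66467878824354, 66467919173166, 66468120974808, 66469815912738,
  66479703250632, 66479704075890, 66493543730418, 66493549478748, 66562750166514, 66562751006766, 66562790738514,
  66659921635314, 66673520800824, 67144084212408, 67144084449750, 67144366687986, 67822307284950, 67836148572108,
  71213422649154, 71213430061032, 71217659777880, 71310311659566, 75961030277496, 76639207231938]

/-- The same codes, sorted (for the balanced key tree). [folklore] -/
def ecsZ17s6v : List ℕ := ecsZ17s6v_1 ++ ecsZ17s6v_2 ++ ecsZ17s6v_3 ++ ecsZ17s6v_4 ++ ecsZ17s6v_5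

end ZpZpDomino

end Summit.MatrixMultiplication.OmegaCensus
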